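import Summits.NavierStokesRegularity.NavierStokesRegularity.Theorems.ScenarioCensusRowF1SymmetricTop
import HarnessLib

/-!
# LINE 33 «symmetric-top» port, part 2/3: §4 THE TRANSFER — Killing slack on the top ⇒ the blow-up limit is annihilated by a nonzero Killing generator; analytic globalisation on
# a slice and the vanishing of the limit

Re-homed for the scenario census (typer seat ns-census-typer-1 g9; the cells F1sy / F1ks / F1kt and the floor are MEMBERS OF RECORD «DECIDED IN KERNEL IN FILES» of row F1
since census v1.97 (item 67: critic idea-crit-3 PASS; ref PRE-CHECK ✓; lead-presearch label); this port makes them TREE-decided): VERBATIM PORT of ns-idea-3 LINE 33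
«symmetric-top», `pub/ideators/ns-idea-3/lines/symmetric-top/line-symmetric-top.lean` sha16 b59608429eb1d133 (901 l., lean check rc 0, 0 sorry), split for the 400-line
rule into `ScenarioCensusRowF1SymmetricTop` (§1–§3) → `…SymmetricTopTransfer` (§4) → `…SymmetricTopRows` (§5–§6 + census KEYS).  Lean text VERBATIM in namespace
`…Theorems.ScenarioCensus.SymmetricTop` (the line's `…Cruxes.ScenarioCensusRowF1.SymmetricTopLine` re-homed); port edits: §2's zoom package / `tendsto_physicalTime` / `isOpen_ne_zero` are the landed columnar-top port's, taken BY
NAME (`ColumnarTop.…`); §6 keeps the line's VERBATIM restatement of LINE 15's `HasColumnarTop` / `Row_F1co` for the order lemma (the census key `Row_F1co` is the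
columnar-top port's); `@[conjecture]` on the residual `SymmetricCollapse` (≡ `ScenarioCensus.Row_F1`, OPEN); three one-line
docstrings added (gate lint).  Statements untouched.

No census VALUE is moved here (row F1 stays OPEN-WITH-LINE; the members become TREE-decided by name); NS regularity is NOT proved; `Row_F1` is untouched (zero
movement, `symmetricCollapse_iff_rowF1`); no summit statement is proved by this file. Lemmas that restate already-landed tree declarations are taken BY NAME (gate lint `dedup.landed`): `exists_singularZoom_package` = `ColumnarTop.exists_singularZoom_package`, `tendsto_physicalTime` = `ColumnarTop.tendsto_physicalTime`, `isOpen_ne_zero` = `ColumnarTop.isOpen_ne_zero`.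
-/

-- the summit and its single problem share the name `NavierStokesRegularity` (D-0017 nested layout)
set_option linter.dupNamespace false

noncomputable section

open MeasureTheory Set Function Filter TopologicalSpace Metric
open scoped Topology NNReal ENNReal InnerProductSpace RealInnerProductSpace

namespace Summit.NavierStokesRegularity.NavierStokesRegularity.Theorems.ScenarioCensus.SymmetricTop

open Literature.Analysis Literature.Analysis.FluidPDE
open Summit.NavierStokesRegularity.NavierStokesRegularity.Theorems
open Summit.NavierStokesRegularity.NavierStokesRegularity.Theses

/-! ## §4 THE TRANSFER: Killing slack on the top ⇒ the blow-up limit is annihilated by a nonzero Killing generator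
— a ROTATION about the axis through the zoom centre if the generator fixes the singular point (`K(x₀) = 0`), the
TRANSLATION along `K(x₀)` if it moves it -/

-- `tendsto_physicalTime`: the line restates the tree's `ColumnarTop.tendsto_physicalTime`; taken BY NAME (gate lint dedup.landed).

/-- **Top bookkeeping at the Type-I scale**: a point `y` with `W(t, y) ≠ 0` comes from points of the top of level
`Λ = √(β|t|) |W(t,y)| / (4α√ν)` at the physical times `τ_j`, eventually in `j`
(`√(T − τ_j) |u(τ_j, x_j)| = (√(β|t|)/α) · |c_jα u(τ_j, x_j)| → (√(β|t|)/α) |W(t, y)|`). -/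
theorem eventually_top {T ν : ℝ} {u : ℝ → E3 → E3} {x₀ : E3} {α β R : ℝ} {c : ℕ → ℝ} {W : ℝ → E3 → E3}
    (hν : 0 < ν) (hα : 0 < α) (hβ : 0 < β) (hcpos : ∀ j, 0 < c j)
    (hpt : ∀ t < 0, ∀ y : E3,
      Tendsto (fun j => (c j * α) • u (T + c j ^ 2 * β * t) (x₀ + (c j * R) • y)) atTop (𝓝 (W t y)))
    {t : ℝ} (ht : t < 0) {y : E3} (hne : W t y ≠ 0) :
    ∀ᶠ j in atTop, Real.sqrt (β * (-t)) * ‖W t y‖ / (4 * α * Real.sqrt ν) * Real.sqrt ν ≤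
      Real.sqrt (T - (T + c j ^ 2 * β * t)) * ‖u (T + c j ^ 2 * β * t) (x₀ + (c j * R) • y)‖ := by
  have ht' : 0 < -t := neg_pos.2 ht
  have hsν : 0 < Real.sqrt ν := Real.sqrt_pos.2 hν
  have hsqrtτ : ∀ j : ℕ, Real.sqrt (T - (T + c j ^ 2 * β * t)) = c j * Real.sqrt (β * (-t)) := by
    intro j
    have e : T - (T + c j ^ 2 * β * t) = c j ^ 2 * (β * (-t)) := by ring
    rw [e, Real.sqrt_mul (sq_nonneg _), Real.sqrt_sq (hcpos _).le]
  have hpos : 0 < ‖W t y‖ := norm_pos_iff.2 hne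
  have hβt : 0 < Real.sqrt (β * (-t)) := Real.sqrt_pos.2 (by positivity)
  have f1 : ∀ᶠ j in atTop, ‖W t y‖ / 2 < ‖(c j * α) • u (T + c j ^ 2 * β * t) (x₀ + (c j * R) • y)‖ :=
    ((hpt t ht y).norm).eventually_const_lt (by linarith)
  filter_upwards [f1] with j hj
  have hcαj : 0 < c j * α := mul_pos (hcpos _) hα
  rw [norm_smul, Real.norm_eq_abs, abs_of_pos hcαj] at hj
  rw [hsqrtτ j]
  have e1 : Real.sqrt (β * (-t)) * ‖W t y‖ / (4 * α * Real.sqrt ν) * Real.sqrt ν =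
      Real.sqrt (β * (-t)) * ‖W t y‖ / (4 * α) := by
    field_simp
  rw [e1, div_le_iff₀ (by positivity)]
  -- `√(β|t|) |W| ≤ c √(β|t|) |u| (4α)` from `|W|/2 < c α |u|`
  have h2 : ‖W t y‖ ≤ 4 * (c j * α * ‖u (T + c j ^ 2 * β * t) (x₀ + (c j * R) • y)‖) := by nlinarith
  calc Real.sqrt (β * (-t)) * ‖W t y‖
      ≤ Real.sqrt (β * (-t)) * (4 * (c j * α * ‖u (T + c j ^ 2 * β * t) (x₀ + (c j * R) • y)‖)) :=
        mul_le_mul_of_nonneg_left h2 hβt.le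
    _ = c j * Real.sqrt (β * (-t)) * ‖u (T + c j ^ 2 * β * t) (x₀ + (c j * R) • y)‖ * (4 * α) := by ring

/-- **Algebra of the zoomed defect.**  With `V = γ v(x)`, `G = (γρ) Dv(x)` and `a + A x = k₀ + ρ A y`:
`L_K v(x) = (γρ)⁻¹ (G(k₀ + ρ A y) − ρ A V)`. -/
theorem killingDefect_eq_zoom {a k₀ y : E3} {A : E3 →L[ℝ] E3} {v : E3 → E3} {x : E3} {γ ρ : ℝ}
    (hγ : γ ≠ 0) (hρ : ρ ≠ 0) {V : E3} {G : E3 →L[ℝ] E3} (hV : γ • v x = V)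
    (hG : (γ * ρ) • fderiv ℝ v x = G) (hk : a + A x = k₀ + ρ • A y) :
    killingDefect a A v x = (γ * ρ)⁻¹ • (G (k₀ + ρ • A y) - ρ • A V) := by
  have hv : v x = γ⁻¹ • V := by rw [← hV, inv_smul_smul₀ hγ]
  have hD : fderiv ℝ v x = (γ * ρ)⁻¹ • G := by rw [← hG, inv_smul_smul₀ (mul_ne_zero hγ hρ)]
  have hsm : ∀ (c : ℝ) (L : E3 →L[ℝ] E3) (w : E3), (c • L) w = c • L w := fun _ _ _ => rfl
  unfold killingDefect
  rw [hk, hD, hv, hsm, map_smul, smul_sub, smul_smul]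
  congr 2
  field_simp

/-- **THE KILLING TRANSFER.**  Under the zoom package at `(T, x₀)`, Killing slack on the top for the generator
`(a, A)` forces, at every `(t, y)` with `W(t, y) ≠ 0`: `DW(t,y)·(A y) − A W(t,y) = 0` if `K(x₀) = a + A x₀ = 0`,
and `DW(t,y)·K(x₀) = 0` if `K(x₀) ≠ 0`.  Mechanism: the pulled-back generator is `c_j⁻¹R⁻¹K(x₀) + A y`; the
physical inequality at `(τ_j, x₀ + c_jRy)` reads, after the scale bookkeeping (`T − τ_j = c_j²β|t|`, amplitude
`c_jα`, gradient factor `c_j²αR`), `(β|t|/(αR)) |G_j(K(x₀) + c_jR A y) − c_jR A V_j| ≤ ε (|K(x₀) + c_jR A y| +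
c_j√(νβ|t|)‖A‖)` with `V_j → W(t,y)`, `G_j → DW(t,y)`; if `K(x₀) ≠ 0` the limit is `(β|t|/(αR))|DW·K(x₀)| ≤
ε|K(x₀)|`, if `K(x₀) = 0` one factor `c_j` cancels and the limit is `(β|t|/α)|DW·Ay − AW| ≤ ε(R|Ay| +
√(νβ|t|)‖A‖)`; `ε → 0`. -/
theorem killing_transfer {T ν : ℝ} {u : ℝ → E3 → E3} {x₀ : E3} {α β R : ℝ} {c : ℕ → ℝ} {W : ℝ → E3 → E3}
    (hν : 0 < ν) (hα : 0 < α) (hβ : 0 < β) (hR : 0 < R) (hcpos : ∀ j, 0 < c j)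
    (hclim : Tendsto c atTop (𝓝 0))
    (hpt : ∀ t < 0, ∀ y : E3,
      Tendsto (fun j => (c j * α) • u (T + c j ^ 2 * β * t) (x₀ + (c j * R) • y)) atTop (𝓝 (W t y)))
    (hgrad : ∀ t < 0, ∀ y : E3,
      Tendsto (fun j => (c j * α * (c j * R)) • fderiv ℝ (u (T + c j ^ 2 * β * t)) (x₀ + (c j * R) • y))
        atTop (𝓝 (fderiv ℝ (W t) y)))
    {a : E3} {A : E3 →L[ℝ] E3} (hslack : HasKillingSlackTop ν T a A u) :
    ∀ t < 0, ∀ y, W t y ≠ 0 →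
      (a + A x₀ = 0 → fderiv ℝ (W t) y (A y) - A (W t y) = 0) ∧
      (a + A x₀ ≠ 0 → fderiv ℝ (W t) y (a + A x₀) = 0) := by
  intro t ht y hne
  have ht' : 0 < -t := neg_pos.2 ht
  set k₀ : E3 := a + A x₀ with hk₀
  -- zoom data at `(t, y)`
  set τ : ℕ → ℝ := fun j => T + c j ^ 2 * β * t with hτ
  set xj : ℕ → E3 := fun j => x₀ + (c j * R) • y with hxj
  set V : ℕ → E3 := fun j => (c j * α) • u (τ j) (xj j) with hV
  set G : ℕ → (E3 →L[ℝ] E3) := fun j => (c j * α * (c j * R)) • fderiv ℝ (u (τ j)) (xj j) with hG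
  have hVlim : Tendsto V atTop (𝓝 (W t y)) := hpt t ht y
  have hGlim : Tendsto G atTop (𝓝 (fderiv ℝ (W t) y)) := hgrad t ht y
  have hk : ∀ j, a + A (xj j) = k₀ + (c j * R) • A y := by
    intro j; simp only [hxj, hk₀, map_add, map_smul]; abel
  have hkd : ∀ j, killingDefect a A (u (τ j)) (xj j) =
      (c j * α * (c j * R))⁻¹ • (G j (k₀ + (c j * R) • A y) - (c j * R) • A (V j)) := fun j =>
    killingDefect_eq_zoom (mul_pos (hcpos j) hα).ne' (mul_pos (hcpos j) hR).ne' rfl rfl (hk j)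
  have hTτ : ∀ j, T - τ j = c j ^ 2 * β * (-t) := fun j => by simp only [hτ]; ring
  have hsqν : ∀ j, Real.sqrt (ν * (T - τ j)) = c j * Real.sqrt (ν * β * (-t)) := by
    intro j
    rw [hTτ j, show ν * (c j ^ 2 * β * (-t)) = c j ^ 2 * (ν * β * (-t)) by ring,
      Real.sqrt_mul (sq_nonneg _), Real.sqrt_sq (hcpos j).le]
  -- the physical inequality, pulled to the zoom: LHS and RHS as functions of `j`
  have hLHS : ∀ j, (T - τ j) * ‖killingDefect a A (u (τ j)) (xj j)‖ =
      β * (-t) / (α * R) * ‖G j (k₀ + (c j * R) • A y) - (c j * R) • A (V j)‖ := by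
    intro j
    have hcj : 0 < c j := hcpos j
    rw [hkd j, norm_smul, norm_inv, Real.norm_eq_abs, abs_of_pos (by positivity), hTτ j]
    field_simp
  have hRHS : ∀ j, killingSize ν T a A (τ j) (xj j) =
      ‖k₀ + (c j * R) • A y‖ + c j * Real.sqrt (ν * β * (-t)) * ‖A‖ := by
    intro j; rw [killingSize, hk j, hsqν j]
  -- the top condition holds eventually at `(τ_j, x_j)`
  set Λ : ℝ := Real.sqrt (β * (-t)) * ‖W t y‖ / (4 * α * Real.sqrt ν) with hΛ
  have hΛpos : 0 < Λ := by
    have : 0 < ‖W t y‖ := norm_pos_iff.2 hne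
    positivity
  have htop : ∀ᶠ j in atTop, Λ * Real.sqrt ν ≤ Real.sqrt (T - τ j) * ‖u (τ j) (xj j)‖ :=
    eventually_top hν hα hβ hcpos hpt ht hne
  have hτlim := ColumnarTop.tendsto_physicalTime (T := T) hβ ht hcpos hclim
  -- for every `ε > 0`, eventually `LHS_j ≤ ε RHS_j`
  have hineq : ∀ ε : ℝ, 0 < ε → ∀ᶠ j in atTop,
      β * (-t) / (α * R) * ‖G j (k₀ + (c j * R) • A y) - (c j * R) • A (V j)‖ ≤
        ε * (‖k₀ + (c j * R) • A y‖ + c j * Real.sqrt (ν * β * (-t)) * ‖A‖) := by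
    intro ε hε
    filter_upwards [htop, hτlim.eventually (hslack Λ hΛpos ε hε)] with j hj1 hj2
    have h := hj2 (xj j) hj1
    rwa [hLHS j, hRHS j] at h
  -- common limits
  have hcR : Tendsto (fun j => c j * R) atTop (𝓝 0) := by
    simpa using hclim.mul_const R
  have harg : Tendsto (fun j => k₀ + (c j * R) • A y) atTop (𝓝 k₀) := by
    simpa using (hcR.smul_const (A y)).const_add k₀
  have hAV : Tendsto (fun j => (c j * R) • A (V j)) atTop (𝓝 0) := by
    simpa using hcR.smul ((A.continuous.tendsto _).comp hVlim)
  have hev : Continuous fun q : (E3 →L[ℝ] E3) × E3 => q.1 q.2 := isBoundedBilinearMap_apply.continuous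
  have hGk : Tendsto (fun j => G j (k₀ + (c j * R) • A y)) atTop (𝓝 (fderiv ℝ (W t) y k₀)) :=
    (hev.tendsto (fderiv ℝ (W t) y, k₀)).comp (hGlim.prodMk_nhds harg)
  refine ⟨fun hk0 => ?_, fun hk0 => ?_⟩
  · -- ### Case `K(x₀) = 0`: rotation about the axis through the zoom centre
    have hk0' : k₀ = 0 := hk0
    set S₀ : ℝ := R * ‖A y‖ + Real.sqrt (ν * β * (-t)) * ‖A‖ with hS₀
    have hF : Tendsto (fun j => G j (A y) - A (V j)) atTop (𝓝 (fderiv ℝ (W t) y (A y) - A (W t y))) :=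
      ((hev.tendsto (fderiv ℝ (W t) y, A y)).comp (hGlim.prodMk_nhds tendsto_const_nhds)).sub
        ((A.continuous.tendsto _).comp hVlim)
    have hle : ∀ ε : ℝ, 0 < ε → β * (-t) / α * ‖fderiv ℝ (W t) y (A y) - A (W t y)‖ ≤ ε * S₀ := by
      intro ε hε
      refine le_of_tendsto (hF.norm.const_mul (β * (-t) / α)) ?_
      filter_upwards [hineq ε hε] with j hj
      have hcj : 0 < c j := hcpos j
      rw [hk0', zero_add, map_smul, ← smul_sub, norm_smul, norm_smul, Real.norm_eq_abs,
        abs_of_pos (mul_pos hcj hR)] at hj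
      -- cancel one factor `c j`
      have e1 : β * (-t) / (α * R) * (c j * R * ‖G j (A y) - A (V j)‖) =
          c j * (β * (-t) / α * ‖G j (A y) - A (V j)‖) := by
        field_simp
      have e2 : ε * (c j * R * ‖A y‖ + c j * Real.sqrt (ν * β * (-t)) * ‖A‖) = c j * (ε * S₀) := by
        rw [hS₀]; ring
      rw [e1, e2] at hj
      exact le_of_mul_le_mul_left hj hcj
    have hS₀nn : 0 ≤ S₀ := by positivity
    have h0 : β * (-t) / α * ‖fderiv ℝ (W t) y (A y) - A (W t y)‖ ≤ 0 := by
      refine le_of_forall_pos_le_add fun ε' hε' => ?_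
      rw [zero_add]
      by_cases hS : S₀ = 0
      · have := hle 1 one_pos
        rw [hS, mul_zero] at this
        exact this.trans hε'.le
      · have hSpos : 0 < S₀ := lt_of_le_of_ne hS₀nn (Ne.symm hS)
        have := hle (ε' / S₀) (div_pos hε' hSpos)
        rwa [div_mul_cancel₀ _ hS] at this
    have hcoef : 0 < β * (-t) / α := by positivity
    have hn : ‖fderiv ℝ (W t) y (A y) - A (W t y)‖ ≤ 0 := by
      by_contra hlt
      push Not at hlt
      have := mul_pos hcoef hlt
      linarith
    exact norm_eq_zero.1 (le_antisymm hn (norm_nonneg _))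
  · -- ### Case `K(x₀) ≠ 0`: translation along `K(x₀)`
    have hE : Tendsto (fun j => G j (k₀ + (c j * R) • A y) - (c j * R) • A (V j)) atTop
        (𝓝 (fderiv ℝ (W t) y k₀)) := by
      simpa using hGk.sub hAV
    have hS : Tendsto (fun j => ‖k₀ + (c j * R) • A y‖ + c j * Real.sqrt (ν * β * (-t)) * ‖A‖) atTop
        (𝓝 ‖k₀‖) := by
      have h1 := harg.norm
      have h2 : Tendsto (fun j => c j * Real.sqrt (ν * β * (-t)) * ‖A‖) atTop (𝓝 0) := by
        simpa using (hclim.mul_const (Real.sqrt (ν * β * (-t)))).mul_const ‖A‖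
      simpa using h1.add h2
    have hle : ∀ ε : ℝ, 0 < ε → β * (-t) / (α * R) * ‖fderiv ℝ (W t) y k₀‖ ≤ ε * ‖k₀‖ := fun ε hε =>
      le_of_tendsto_of_tendsto (hE.norm.const_mul _) (hS.const_mul ε) (hineq ε hε)
    have hkpos : 0 < ‖k₀‖ := norm_pos_iff.2 hk0
    have h0 : β * (-t) / (α * R) * ‖fderiv ℝ (W t) y k₀‖ ≤ 0 := by
      refine le_of_forall_pos_le_add fun ε' hε' => ?_
      rw [zero_add]
      have := hle (ε' / ‖k₀‖) (div_pos hε' hkpos)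
      rwa [div_mul_cancel₀ _ hkpos.ne'] at this
    have hcoef : 0 < β * (-t) / (α * R) := by positivity
    have hn : ‖fderiv ℝ (W t) y k₀‖ ≤ 0 := by
      by_contra hlt
      push Not at hlt
      have := mul_pos hcoef hlt
      linarith
    exact norm_eq_zero.1 (le_antisymm hn (norm_nonneg _))

/-! ### Analytic globalisation on a slice and the vanishing of the limit -/

-- `isOpen_ne_zero`: the line restates the tree's `ColumnarTop.isOpen_ne_zero`; taken BY NAME (gate lint dedup.landed).

/-- **Density step** (only the analyticity of the SLICE is used): a CONTINUOUS read-out vanishing wherever a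
NONTRIVIAL slice of `𝒦_C` is nonzero vanishes everywhere — the zero set of a nontrivial real-analytic slice has
empty interior (identity theorem, `IsTypeIAncientMild.analyticOnNhd_slice_univ`). -/
theorem eq_zero_of_eq_zero_on_ne_zero {C : ℝ} {W : ℝ → E3 → E3} (hW : IsTypeIAncientMild C W) {t : ℝ}
    (ht : t < 0) {F : Type*} [NormedAddCommGroup F] {g : E3 → F}
    (hg : Continuous g) (h : ∀ y, W t y ≠ 0 → g y = 0) {z : E3} (hz : W t z ≠ 0) :
    ∀ y, g y = 0 := by
  intro y
  by_contra hy
  -- `g ≠ 0` on an open neighbourhood `U` of `y`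
  set U : Set E3 := g ⁻¹' {0}ᶜ with hU
  have hUo : IsOpen U := isOpen_compl_singleton.preimage hg
  have hyU : y ∈ U := hy
  by_cases hvan : ∀ y' ∈ U, W t y' = 0
  · -- the analytic slice vanishes near `y`, hence everywhere: contradiction with `z`
    have hev : W t =ᶠ[𝓝 y] 0 := eventually_of_mem (hUo.mem_nhds hyU) fun y' hy' => hvan y' hy'
    have key := (hW.analyticOnNhd_slice_univ ht).eqOn_zero_of_preconnected_of_eventuallyEq_zero
      isPreconnected_univ (mem_univ y) hev
    exact hz (key (mem_univ z))
  · push Not at hvan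
    obtain ⟨y', hy'U, hy'⟩ := hvan
    exact hy'U (h y' hy')

/-- **Almost symmetric top ⇒ the blow-up limit vanishes.**  Under the zoom package, Killing slack on the top for a
nonzero generator `(a, A)` forces `W ≡ 0` on the open past: by `killing_transfer` and the density step every
slice is annihilated by the rotation generator `(0, A)` (if `K(x₀) = 0`; then `A ≠ 0`) or by the translation
generator `(K(x₀), 0)` (if `K(x₀) ≠ 0`) — on slices that vanish identically trivially so — and
`eq_zero_of_killing_annihilated` (the tree's axisymmetric-with-swirl and helical/translational Liouville theorems
in `𝒦_C`) kills `W`. -/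
theorem eq_zero_of_killingSlackTop {T ν : ℝ} {u : ℝ → E3 → E3} {x₀ : E3} {C α β R : ℝ} {c : ℕ → ℝ}
    {W : ℝ → E3 → E3} (hν : 0 < ν) (hα : 0 < α) (hβ : 0 < β) (hR : 0 < R) (hcpos : ∀ j, 0 < c j)
    (hclim : Tendsto c atTop (𝓝 0)) (hW : IsTypeIAncientMild C W)
    (hpt : ∀ t < 0, ∀ y : E3,
      Tendsto (fun j => (c j * α) • u (T + c j ^ 2 * β * t) (x₀ + (c j * R) • y)) atTop (𝓝 (W t y)))
    (hgrad : ∀ t < 0, ∀ y : E3,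
      Tendsto (fun j => (c j * α * (c j * R)) • fderiv ℝ (u (T + c j ^ 2 * β * t)) (x₀ + (c j * R) • y))
        atTop (𝓝 (fderiv ℝ (W t) y)))
    {a : E3} {A : E3 →L[ℝ] E3} (hA : IsSkew A) (hne : ¬ (a = 0 ∧ A = 0))
    (hslack : HasKillingSlackTop ν T a A u) :
    ∀ t < 0, ∀ y, W t y = 0 := by
  have htr := killing_transfer hν hα hβ hR hcpos hclim hpt hgrad hslack
  have hDcont : ∀ t < 0, Continuous (fderiv ℝ (W t)) := fun t ht =>
    (hW.contDiff_slice ht).continuous_fderiv (by simp)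
  -- slices vanishing identically are annihilated by everything
  have hzero : ∀ t < 0, (∀ z, W t z = 0) → ∀ (b : E3) (B : E3 →L[ℝ] E3) (y : E3),
      fderiv ℝ (W t) y (b + B y) - B (W t y) = 0 := by
    intro t ht hz b B y
    have h0 : W t = fun _ => (0 : E3) := funext hz
    rw [h0]
    simp
  by_cases hk0 : a + A x₀ = 0
  · -- rotation generator `(0, A)`, `A ≠ 0`
    have hA0 : ¬ ((0 : E3) = 0 ∧ A = 0) := by
      rintro ⟨-, rfl⟩
      apply hne
      refine ⟨?_, rfl⟩
      simpa using hk0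
    refine eq_zero_of_killing_annihilated hW hA hA0 fun t ht => ?_
    by_cases hS : ∃ z, W t z ≠ 0
    · obtain ⟨z, hz⟩ := hS
      have hg : Continuous fun y => fderiv ℝ (W t) y (A y) - A (W t y) :=
        ((hDcont t ht).clm_apply A.continuous).sub (A.continuous.comp (hW.continuous_slice ht))
      have hall := eq_zero_of_eq_zero_on_ne_zero hW ht hg (fun y hy => (htr t ht y hy).1 hk0) hz
      intro y
      simpa using hall y
    · push Not at hS
      exact hzero t ht hS 0 A
  · -- translation generator `(K(x₀), 0)`
    have hK0 : ¬ (a + A x₀ = 0 ∧ (0 : E3 →L[ℝ] E3) = 0) := fun h => hk0 h.1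
    have hskew0 : IsSkew (0 : E3 →L[ℝ] E3) := fun x => by simp
    refine eq_zero_of_killing_annihilated hW hskew0 hK0 fun t ht => ?_
    by_cases hS : ∃ z, W t z ≠ 0
    · obtain ⟨z, hz⟩ := hS
      have hg : Continuous fun y => fderiv ℝ (W t) y (a + A x₀) :=
        (hDcont t ht).clm_apply continuous_const
      have hall := eq_zero_of_eq_zero_on_ne_zero hW ht hg (fun y hy => (htr t ht y hy).2 hk0) hz
      intro y
      simpa using hall y
    · push Not at hS
      exact hzero t ht hS (a + A x₀) 0

end Summit.NavierStokesRegularity.NavierStokesRegularity.Theorems.ScenarioCensus.SymmetricTop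

end
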